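import Summits.BirchSwinnertonDyer.BirchSwinnertonDyer.Theorems.Rank1ResidualIntModelReduction
import Summits.BirchSwinnertonDyer.Rank1Residual.X12.SpecialJIrreducible
import Literature.NumberTheory.EllipticCurves.HeightDensityFullBSDOffS
import Literature.NumberTheory.EllipticCurves.LFunctionSmulProofs
import Literature.NumberTheory.EllipticCurves.LFunctionPrimeCoeff
import Literature.NumberTheory.EllipticCurves.LeadingTermBSZOrdinaryProofs
import Literature.NumberTheory.EllipticCurves.OpenImageMazurAssemblyProofs
import Literature.NumberTheory.EllipticCurves.GlobalMinimalModelProofs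
import Literature.NumberTheory.EllipticCurves.PAdicLFunction
import Literature.NumberTheory.Automorphic.LangWave0Proofs
import Literature.NumberTheory.DiophantineGeometry.LocalReductionFiniteBadPlacesProofs
import Literature.NumberTheory.DiophantineGeometry.LocalReductionHasMultiplicativeReductionAtProofs
import Literature.NumberTheory.DiophantineGeometry.LocalReductionMinimalityProofs
import Literature.NumberTheory.EllipticCurves.RootNumberTwistProofs
import Literature.NumberTheory.EllipticCurves.SzpiroMinimalityProofs
import Literature.NumberTheory.EllipticCurves.ModularCurveManinSemistableCoprimeFormProofs
import Literature.NumberTheory.EllipticCurves.NeronLocalHeightCompletion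
import Mathlib.NumberTheory.Padics.HeightOneSpectrum
import HarnessLib
/-!
# Cell bsd-rank2 (TWIN leaf `PAdicBSDRankTwoPositiveProportion`, door D-count): local data of an
# elliptic curve over `ℚ` READ OFF AN ARBITRARY INTEGER MODEL and transported to the globally
# minimal model — good reduction and `a_ℓ` at `ℓ ∤ Δ`, ordinarity, Mazur's Frobenius certificate for
# `ρ̄_p`, and multiplicative reduction with `ord_ℓ Δ_min = 1` at `ord_ℓ Δ = 1`

Cell-side file (cell bsd-rank2, seat bsd-rank2-lit GEN 10; serves the support items
`CountingBridge` (stmt-BirchSwinnertonDyer-19484) and `GenericMembersLargeF2` of the D-0059 route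
`route-BirchSwinnertonDyer-CountingDoorF2AtThree`, see `HOME/lit/LIT-R2.md` §1w (d) R1/R3; the
companion `F2MemberLocalData.lean` specialises everything to the members of Bhargava–Ho's `F₂`).
The TWIN leaf quantifies over a GLOBALLY MINIMAL model `C • E_ℚ` of a member given by an integer
model `E` (not minimal in general), while a congruence family sees only the residues of `E`'s
coefficients. This file is the dictionary for an arbitrary `E : WeierstrassCurve ℤ`, theorems only
(no definition, no fact, no instance); the cell b2b-bsdres toolkit
`Rank1Residual.IntModel.*` (file `Theorems/Rank1ResidualIntModelReduction.lean`) covers the case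
where the integer model IS the minimal model (`integralModelInt W = E₀`), this one the general case:

* `hasGoodReductionAtPrime_map_of_not_dvd` — `ℓ ∤ Δ(E)` ⟹ `E_ℚ` has good reduction at `ℓ`
  (`ℓ`-integral with unit discriminant: Silverman VII.1 Rem. 1.1, VII.5 Prop. 5.1(a));
* `frobeniusTrace_eq_of_smul_map_eq` — for a globally minimal `W = C • E_ℚ` and `ℓ ∤ Δ(E)`:
  `a_ℓ(W) = ℓ + 1 - #E(𝔽_ℓ)` computed on `E` ITSELF (`Automorphic.frobeniusTrace E ℓ`); both sides
  are the `ℓ`-th coefficient of the isomorphism-invariant `L`-function (tree theorems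
  `LFunction_smul`, `LFunction_apply_prime_eq_frobeniusTrace`,
  `Automorphic.lFunction_map_apply_prime_of_not_dvd`); `isOrdinaryAt_of_smul_map_eq` — hence
  `IsOrdinaryAt W ℓ` iff `ℓ ∤ ℓ + 1 - #E(𝔽_ℓ)`;
* `hasIrreducibleModPGaloisRep_map_of_noroot` — Mazur's Frobenius certificate (1978, Prop. 6.3 (1);
  tree theorem `Rank1Residual.X12.irr_of_frobeniusTrace_of_forall_ne_zero` for a globally minimal
  `W`: a good prime `ℓ ≠ p` at which `X² - a_ℓ X + ℓ` has no root mod `p` forces `E[p]` irreducible)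
  read off an arbitrary integer model with `ℓ ∤ Δ(E)` (global minimal model by
  `hasGlobalMinimalModel_rat_holds`, invariance `Mazur1978.hasIrreducibleModPGaloisRep_smul_iff`);
* `not_dvd_c₄_of_padicValInt_Δ_eq_one`, `hasMultiplicativeReductionAtPrime_smul_map_of_padicValInt_Δ_eq_one`,
  `padicValInt_minimalDiscriminantInt_eq_of_smul_map_eq`, `haux_of_padicValInt_Δ_eq_one` —
  `ord_ℓ Δ(E) = 1` at `ℓ ≥ 5` gives multiplicative reduction at `ℓ` on every model and
  `ord_ℓ Δ_min = 1` (the auxiliary-prime hypothesis `haux` of `skinner_urban_main_conjecture` /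
  `doorKernel_at_three`); `ord_ℓ Δ_min = ord_ℓ Δ(E)` whenever `ord_ℓ Δ(E) < 12`.

PARTITION: none — r_an ≥ 2, summit axis S0; TWIN (D-0056): n/a. B1 honesty: local algebra of
Weierstrass models; nothing here mentions a Selmer group, an `L`-value or the analytic rank (the
Hasse–Weil `L`-function enters only through its `ℓ`-th Dirichlet coefficient `a_ℓ`).

References: J. H. Silverman, *AEC* (2009) VII.1 Rem. 1.1, Prop. VII.1.3(b), VII.5 Prop. 5.1(a),(b),
VIII.8 Cor. 8.3, Exercise 8.19(a) [SilvermanAEC2009]; B. Mazur, Invent. Math. 44 (1978) §5 and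
Prop. 6.3 (1) [Mazur1978].
-/

noncomputable section

open scoped Classical

open IsDedekindDomain NumberField Rat.HeightOneSpectrum WeierstrassCurve Polynomial
  Literature.NumberTheory.EllipticCurves Literature.NumberTheory.GaloisRepresentations

namespace Summit.BirchSwinnertonDyer.Rank2

/-! ### Integer models with `ℓ ∤ Δ`: good reduction and `a_ℓ` on any globally minimal model -/

/-- An integer model with nonzero discriminant defines an elliptic curve over `ℚ`. [folklore] -/
theorem isElliptic_map_of_Δ_ne_zero (E : WeierstrassCurve ℤ) (hΔ : E.Δ ≠ 0) :
    (E.map (Int.castRingHom ℚ)).IsElliptic := by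
  rw [WeierstrassCurve.isElliptic_iff, map_Δ, isUnit_iff_ne_zero, eq_intCast, Int.cast_ne_zero]
  exact hΔ

/-- **Good reduction at `ℓ ∤ Δ(E)` for an integer model `E`**: the equation is `ℓ`-integral with
`ℓ`-unit discriminant, hence minimal at `ℓ` with nonsingular reduction (Silverman VII.1 Rem. 1.1,
VII.5 Prop. 5.1(a); tree: `hasGoodReductionAt_of_valuation_le_one_of_valuation_Δ_eq_one` and the
prime/place bridge `hasGoodReductionAtPrime_iff_hasGoodReductionAt_ringOfIntegers`).
[cite: SilvermanAEC2009, VII.5 Prop. 5.1(a) with VII.1 Rem. 1.1] -/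
theorem hasGoodReductionAtPrime_map_of_not_dvd (E : WeierstrassCurve ℤ) (ℓ : ℕ) [hℓ : Fact ℓ.Prime]
    (hℓΔ : ¬ (ℓ : ℤ) ∣ E.Δ) : (E.map (Int.castRingHom ℚ)).HasGoodReductionAtPrime ℓ := by
  obtain ⟨v, hv⟩ : ∃ v : HeightOneSpectrum (𝓞 ℚ), (primesEquiv v : ℕ) = ℓ :=
    ⟨primesEquiv.symm ⟨ℓ, hℓ.out⟩, by rw [Equiv.apply_symm_apply]⟩
  set W : WeierstrassCurve ℚ := E.map (Int.castRingHom ℚ) with hW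
  have hΔ1 : v.valuation ℚ W.Δ = 1 := by
    rw [hW, map_Δ, eq_intCast]
    exact Literature.NumberTheory.Automorphic.valuation_intCast_eq_one_of_not_dvd v (by rw [hv]; exact hℓΔ)
  have h₁ : v.valuation ℚ W.a₁ ≤ 1 := by
    rw [hW, map_a₁, eq_intCast]; exact Literature.NumberTheory.Automorphic.valuation_intCast_le_one v _
  have h₂ : v.valuation ℚ W.a₂ ≤ 1 := by
    rw [hW, map_a₂, eq_intCast]; exact Literature.NumberTheory.Automorphic.valuation_intCast_le_one v _
  have h₃ : v.valuation ℚ W.a₃ ≤ 1 := by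
    rw [hW, map_a₃, eq_intCast]; exact Literature.NumberTheory.Automorphic.valuation_intCast_le_one v _
  have h₄ : v.valuation ℚ W.a₄ ≤ 1 := by
    rw [hW, map_a₄, eq_intCast]; exact Literature.NumberTheory.Automorphic.valuation_intCast_le_one v _
  have h₆ : v.valuation ℚ W.a₆ ≤ 1 := by
    rw [hW, map_a₆, eq_intCast]; exact Literature.NumberTheory.Automorphic.valuation_intCast_le_one v _
  have hgood : W.HasGoodReductionAt v :=
    W.hasGoodReductionAt_of_valuation_le_one_of_valuation_Δ_eq_one v h₁ h₂ h₃ h₄ h₆ hΔ1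
  subst hv
  exact (hasGoodReductionAtPrime_iff_hasGoodReductionAt_ringOfIntegers v W).mpr hgood

/-- **`a_ℓ` of a globally minimal model, read off any integer model with `ℓ ∤ Δ`.** If
`W = C • E_ℚ` is globally minimal and `ℓ ∤ Δ(E)`, then `W` has good reduction at `ℓ` and
`a_ℓ(W) = ℓ + 1 - #E(𝔽_ℓ)` (`Automorphic.frobeniusTrace E ℓ`, the point count of `E` ITSELF
modulo `ℓ`): both are the `ℓ`-th Dirichlet coefficient of `L(E_ℚ, s) = L(W, s)` (Silverman,
Exercise 8.19(a); two `ℓ`-minimal equations have isomorphic reductions, Prop. VII.1.3(b)).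
[cite: SilvermanAEC2009, Exercise 8.19(a) and Prop. VII.1.3(b)] -/
theorem frobeniusTrace_eq_of_smul_map_eq (E : WeierstrassCurve ℤ) (W : WeierstrassCurve ℚ)
    [W.IsElliptic] [W.IsGloballyMinimal] (C : VariableChange ℚ)
    (hW : C • E.map (Int.castRingHom ℚ) = W) (ℓ : ℕ) [hℓ : Fact ℓ.Prime] (hℓΔ : ¬ (ℓ : ℤ) ∣ E.Δ) :
    W.HasGoodReductionAtPrime ℓ ∧
      W.frobeniusTrace ℓ = Literature.NumberTheory.Automorphic.frobeniusTrace E ℓ := by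
  have hΔ : E.Δ ≠ 0 := fun h ↦ hℓΔ (h ▸ dvd_zero _)
  haveI : (E.map (Int.castRingHom ℚ)).IsElliptic := isElliptic_map_of_Δ_ne_zero E hΔ
  have hgoodE := hasGoodReductionAtPrime_map_of_not_dvd E ℓ hℓΔ
  have hgoodW : W.HasGoodReductionAtPrime ℓ := by
    rw [← hW]; exact (BSZLemma17.hasGoodReductionAtPrime_smul_iff _ C ℓ).mpr hgoodE
  refine ⟨hgoodW, ?_⟩
  have h1 := LFunction_apply_prime_eq_frobeniusTrace W ℓ hgoodW
  have h2 : W.LFunction = (E.map (Int.castRingHom ℚ)).LFunction := by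
    rw [← hW]; exact LFunction_smul _ C
  have h3 := Literature.NumberTheory.Automorphic.lFunction_map_apply_prime_of_not_dvd E hℓ.out hℓΔ
  rw [h2, h3] at h1
  exact_mod_cast h1.symm

/-- **Ordinarity of the minimal model, read off any integer model**: with `W = C • E_ℚ` globally
minimal, `ℓ ∤ Δ(E)` and `ℓ ∤ ℓ + 1 - #E(𝔽_ℓ)`, `W` is good ordinary at `ℓ` (`IsOrdinaryAt`).
[cite: SilvermanAEC2009, Exercise 8.19(a) and Prop. VII.1.3(b)] -/
theorem isOrdinaryAt_of_smul_map_eq (E : WeierstrassCurve ℤ) (W : WeierstrassCurve ℚ)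
    [W.IsElliptic] [W.IsGloballyMinimal] (C : VariableChange ℚ)
    (hW : C • E.map (Int.castRingHom ℚ) = W) (ℓ : ℕ) [Fact ℓ.Prime] (hℓΔ : ¬ (ℓ : ℤ) ∣ E.Δ)
    (hord : ¬ (ℓ : ℤ) ∣ Literature.NumberTheory.Automorphic.frobeniusTrace E ℓ) :
    IsOrdinaryAt W ℓ := by
  obtain ⟨hgood, htr⟩ := frobeniusTrace_eq_of_smul_map_eq E W C hW ℓ hℓΔ
  exact ⟨hgood, by rw [htr]; exact hord⟩

/-! ### Mazur's Frobenius certificate for irreducibility of `E[p]`, read off an integer model -/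

/-- **The Frobenius certificate read off an integer model.** For an integer model `E` with a good
auxiliary prime `ℓ ∤ Δ(E)`, `ℓ ≠ p`, such that `X² - (ℓ + 1 - #E(𝔽_ℓ)) X + ℓ` has no root mod `p`,
the curve `E_ℚ` has irreducible `E[p]`: pass to a global minimal model
(`hasGlobalMinimalModel_rat_holds`), read `a_ℓ` off `E` (`frobeniusTrace_eq_of_smul_map_eq`), apply
Mazur's certificate there and come back by the isomorphism invariance of irreducibility
(`Mazur1978.hasIrreducibleModPGaloisRep_smul_iff`). [cite: Mazur1978, §6 Prop. 6.3 (1) (p. 153)] -/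
theorem hasIrreducibleModPGaloisRep_map_of_noroot (E : WeierstrassCurve ℤ) (p ℓ : ℕ)
    [Fact p.Prime] [Fact ℓ.Prime] (hℓp : ℓ ≠ p) (hℓΔ : ¬ (ℓ : ℤ) ∣ E.Δ)
    (hnoroot : ∀ t : ZMod p,
      t ^ 2 - (Literature.NumberTheory.Automorphic.frobeniusTrace E ℓ : ZMod p) * t + (ℓ : ZMod p) ≠ 0) :
    (E.map (Int.castRingHom ℚ)).HasIrreducibleModPGaloisRep p := by
  have hΔ : E.Δ ≠ 0 := fun h ↦ hℓΔ (h ▸ dvd_zero _)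
  haveI : (E.map (Int.castRingHom ℚ)).IsElliptic := isElliptic_map_of_Δ_ne_zero E hΔ
  obtain ⟨C, hC⟩ := hasGlobalMinimalModel_rat_holds (E.map (Int.castRingHom ℚ))
  haveI := hC
  obtain ⟨hgood, htr⟩ :=
    frobeniusTrace_eq_of_smul_map_eq E (C • E.map (Int.castRingHom ℚ)) C rfl ℓ hℓΔ
  have hirr : (C • E.map (Int.castRingHom ℚ)).HasIrreducibleModPGaloisRep p :=
    Summit.BirchSwinnertonDyer.Rank1Residual.X12.irr_of_frobeniusTrace_of_forall_ne_zero _ p ℓ hℓp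
      hgood (by rw [htr]; exact hnoroot)
  exact (Mazur1978.hasIrreducibleModPGaloisRep_smul_iff _ C p).mp hirr

/-! ### Integer models with `ord_ℓ Δ = 1`: multiplicative reduction and `ord_ℓ Δ_min = 1` -/

/-- `ord_ℓ(x) = 1 ↔ ℓ ∣ x ∧ ℓ² ∤ x` (for every integer `x`; `ord_ℓ 0 = 0`). [folklore] -/
theorem padicValInt_eq_one_iff {ℓ : ℕ} [hℓ : Fact ℓ.Prime] (x : ℤ) :
    padicValInt ℓ x = 1 ↔ (ℓ : ℤ) ∣ x ∧ ¬ (ℓ : ℤ) ^ 2 ∣ x := by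
  constructor
  · intro h1
    refine ⟨Literature.NumberTheory.EllipticCurves.natCast_dvd_of_padicValInt_eq_one h1, fun h2 ↦ ?_⟩
    rcases (padicValInt_dvd_iff (p := ℓ) 2 x).mp h2 with h0 | hle
    · rw [h0, padicValInt.zero] at h1; exact zero_ne_one h1
    · omega
  · rintro ⟨h, h2⟩
    exact Summit.BirchSwinnertonDyer.BirchSwinnertonDyer.Rank1Residual.IntModel.padicValInt_eq_of_dvd_of_not_dvd
      ℓ (by rw [pow_one]; exact h) h2

/-- **`ord_ℓ(Δ(E)) = 1` with `ℓ ≥ 5` forces `ℓ ∤ c₄(E)`**: otherwise `ℓ ∣ c₆` (from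
`c₆² = c₄³ - 1728Δ`), so `ℓ² ∣ c₄³ - c₆² = 1728Δ` and, `ℓ` being prime to `1728 = 2⁶3³`,
`ℓ² ∣ Δ`. (Tate's algorithm: `ord(Δ) = 1` is type `I₁`, multiplicative.) [folklore] -/
theorem not_dvd_c₄_of_padicValInt_Δ_eq_one (E : WeierstrassCurve ℤ) {ℓ : ℕ} [hℓ : Fact ℓ.Prime]
    (h5 : 5 ≤ ℓ) (h1 : padicValInt ℓ E.Δ = 1) : ¬ (ℓ : ℤ) ∣ E.c₄ := by
  intro hc₄
  have hprime : Prime (ℓ : ℤ) := Nat.prime_iff_prime_int.mp hℓ.out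
  have hΔ0 : E.Δ ≠ 0 := by
    intro h0
    rw [h0, padicValInt.zero] at h1
    exact zero_ne_one h1
  have hΔ : (ℓ : ℤ) ∣ E.Δ := Literature.NumberTheory.EllipticCurves.natCast_dvd_of_padicValInt_eq_one h1
  have hrel : E.c₆ ^ 2 = E.c₄ ^ 3 - 1728 * E.Δ := by
    have h := E.c_relation
    linear_combination h
  have hc₆sq : (ℓ : ℤ) ∣ E.c₆ ^ 2 := by
    rw [hrel]
    exact dvd_sub (dvd_pow hc₄ three_ne_zero) (hΔ.mul_left 1728)
  have hc₆ : (ℓ : ℤ) ∣ E.c₆ := hprime.dvd_of_dvd_pow hc₆sq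
  have h2 : (ℓ : ℤ) ^ 2 ∣ 1728 * E.Δ := by
    rw [E.c_relation]
    exact dvd_sub ((pow_dvd_pow_of_dvd hc₄ 2).trans (Dvd.intro _ (by ring)))
      (pow_dvd_pow_of_dvd hc₆ 2)
  have h1728 : ¬ (ℓ : ℤ) ∣ 1728 := by
    intro h
    have h' : (ℓ : ℤ) ∣ 2 ^ 6 * 3 ^ 3 := by norm_num; exact h
    rcases hprime.dvd_or_dvd h' with h2' | h3'
    · have := Int.le_of_dvd (by norm_num) (hprime.dvd_of_dvd_pow h2'); omega
    · have := Int.le_of_dvd (by norm_num) (hprime.dvd_of_dvd_pow h3'); omega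
  have hsq : (ℓ : ℤ) ^ 2 ∣ E.Δ := hprime.pow_dvd_of_dvd_mul_left 2 h1728 h2
  rcases (padicValInt_dvd_iff (p := ℓ) 2 E.Δ).mp hsq with h0 | hle
  · exact hΔ0 h0
  · omega

/-- **Multiplicative reduction at `ℓ ≥ 5` with `ord_ℓ Δ(E) = 1`, for every model `C • E_ℚ`**:
`E_ℚ` is `ℓ`-integral with `ℓ ∤ c₄` (`not_dvd_c₄_of_padicValInt_Δ_eq_one`) and `ℓ ∣ Δ`, hence
multiplicative at `ℓ` (Silverman VII.5 Prop. 5.1(b); tree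
`hasMultiplicativeReductionAt_of_valuation_c₄_eq_one`), and multiplicative reduction is an
isomorphism invariant (`BSZLemma17.hasMultiplicativeReductionAtPrime_smul_iff`).
[cite: SilvermanAEC2009, VII.5 Prop. 5.1(b)] -/
theorem hasMultiplicativeReductionAtPrime_smul_map_of_padicValInt_Δ_eq_one (E : WeierstrassCurve ℤ)
    (C : VariableChange ℚ) {ℓ : ℕ} [hℓ : Fact ℓ.Prime] (h5 : 5 ≤ ℓ) (h1 : padicValInt ℓ E.Δ = 1) :
    (C • E.map (Int.castRingHom ℚ)).HasMultiplicativeReductionAtPrime ℓ := by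
  have hΔ0 : E.Δ ≠ 0 := by
    intro h0
    rw [h0, padicValInt.zero] at h1
    exact zero_ne_one h1
  haveI : (E.map (Int.castRingHom ℚ)).IsElliptic := isElliptic_map_of_Δ_ne_zero E hΔ0
  rw [BSZLemma17.hasMultiplicativeReductionAtPrime_smul_iff _ C ℓ]
  obtain ⟨v, hv⟩ : ∃ v : HeightOneSpectrum (𝓞 ℚ), (primesEquiv v : ℕ) = ℓ :=
    ⟨primesEquiv.symm ⟨ℓ, hℓ.out⟩, by rw [Equiv.apply_symm_apply]⟩
  set W : WeierstrassCurve ℚ := E.map (Int.castRingHom ℚ) with hW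
  have h₁ : v.valuation ℚ W.a₁ ≤ 1 := by
    rw [hW, map_a₁, eq_intCast]; exact Literature.NumberTheory.Automorphic.valuation_intCast_le_one v _
  have h₂ : v.valuation ℚ W.a₂ ≤ 1 := by
    rw [hW, map_a₂, eq_intCast]; exact Literature.NumberTheory.Automorphic.valuation_intCast_le_one v _
  have h₃ : v.valuation ℚ W.a₃ ≤ 1 := by
    rw [hW, map_a₃, eq_intCast]; exact Literature.NumberTheory.Automorphic.valuation_intCast_le_one v _
  have h₄ : v.valuation ℚ W.a₄ ≤ 1 := by
    rw [hW, map_a₄, eq_intCast]; exact Literature.NumberTheory.Automorphic.valuation_intCast_le_one v _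
  have h₆ : v.valuation ℚ W.a₆ ≤ 1 := by
    rw [hW, map_a₆, eq_intCast]; exact Literature.NumberTheory.Automorphic.valuation_intCast_le_one v _
  have hint : W.IsIntegralAt v := W.isIntegralAt_of_valuation_le_one v h₁ h₂ h₃ h₄ h₆
  have hc₄ : v.valuation ℚ W.c₄ = 1 := by
    rw [hW, map_c₄, eq_intCast]
    exact Literature.NumberTheory.Automorphic.valuation_intCast_eq_one_of_not_dvd v
      (by rw [hv]; exact not_dvd_c₄_of_padicValInt_Δ_eq_one E h5 h1)
  haveI : Fact (primesEquiv v : ℕ).Prime := ⟨(primesEquiv v).2⟩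
  have hΔ : v.valuation ℚ W.Δ < 1 := by
    rw [hW, map_Δ, eq_intCast, (valuation_equiv_padicValuation v).lt_one_iff_lt_one,
      Rat.padicValuation_cast, Int.padicValuation_lt_one_iff, hv]
    exact Literature.NumberTheory.EllipticCurves.natCast_dvd_of_padicValInt_eq_one h1
  have hmult : W.HasMultiplicativeReductionAt v :=
    hasMultiplicativeReductionAt_of_valuation_c₄_eq_one hint hc₄ hΔ
  subst hv
  exact (hasMultiplicativeReductionAtPrime_iff_hasMultiplicativeReductionAt_ringOfIntegers W v).mpr hmult

/-- **`ord_ℓ Δ_min = ord_ℓ Δ(E)` when `ord_ℓ Δ(E) < 12`**: for a globally minimal `W = C • E_ℚ`,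
the integer model `E` is `ℓ`-integral and minimal at `ℓ` (Silverman VII.1 Rem. 1.1:
`ord_ℓ Δ < 12`), `W` is minimal at `ℓ`, so each of `v(Δ(W))`, `v(Δ(E))` bounds the other
(definition of minimality; tree `valuation_Δ_smul_le_of_isMinimalAt`).
[cite: SilvermanAEC2009, VII.1 Prop. 1.3(b) with Rem. 1.1 (p. 186)] -/
theorem padicValInt_minimalDiscriminantInt_eq_of_smul_map_eq (E : WeierstrassCurve ℤ)
    (W : WeierstrassCurve ℚ) [W.IsElliptic] [W.IsGloballyMinimal] (C : VariableChange ℚ)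
    (hW : C • E.map (Int.castRingHom ℚ) = W) {ℓ : ℕ} [hℓ : Fact ℓ.Prime] (hΔ0 : E.Δ ≠ 0)
    (hlt : padicValInt ℓ E.Δ < 12) :
    padicValInt ℓ W.minimalDiscriminantInt = padicValInt ℓ E.Δ := by
  -- the finite place `v` of `ℤ` below `ℓ`
  set v : IsDedekindDomain.HeightOneSpectrum ℤ :=
    (Rat.HeightOneSpectrum.primesEquiv (R := ℤ)).symm ⟨ℓ, hℓ.out⟩
  have hv : Rat.HeightOneSpectrum.natGenerator v = ℓ :=
    congrArg Subtype.val ((Rat.HeightOneSpectrum.primesEquiv (R := ℤ)).apply_symm_apply ⟨ℓ, hℓ.out⟩)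
  set S : WeierstrassCurve ℚ := E.map (Int.castRingHom ℚ) with hSdef
  have hSint : S = E.baseChange ℚ := by
    rw [hSdef, WeierstrassCurve.baseChange, algebraMap_int_eq]
  have hintS : S.IsIntegralAt v := by rw [hSint]; exact isIntegralAt_baseChange_int v _
  have hΔS : S.Δ = ((E.Δ : ℤ) : ℚ) := by rw [hSdef, map_Δ, eq_intCast]
  have hneS : ((E.Δ : ℤ) : ℚ) ≠ 0 := by exact_mod_cast hΔ0
  -- `S` is minimal at `v`: `ord_v Δ(S) < 12`
  have hminS : S.IsMinimalAt v := by
    refine isMinimalAt_of_lt_valuation_Δ_holds hintS ?_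
    rw [hΔS, Rat.HeightOneSpectrum.valuation_eq_exp_neg_padicValRat v hneS, hv, WithZero.exp_lt_exp,
      padicValRat.of_int, neg_lt_neg_iff]
    exact_mod_cast hlt
  have hminW : W.IsMinimalAt v := IsGloballyMinimal.isMinimalAt_int W v
  have hWint : (integralModelInt W).baseChange ℚ = W := by
    rw [WeierstrassCurve.baseChange, algebraMap_int_eq, map_integralModelInt]
  have hintW : W.IsIntegralAt v := by
    have h := isIntegralAt_baseChange_int v (integralModelInt W)
    rwa [hWint] at h
  -- `v(Δ(W)) = v(Δ(S))`: each is bounded by the other (definition of minimality)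
  have h1 : v.valuation ℚ W.Δ ≤ v.valuation ℚ S.Δ := by
    have h := valuation_Δ_smul_le_of_isMinimalAt v hminS C (by rw [hW]; exact hintW)
    rwa [hW] at h
  have hS' : C⁻¹ • W = S := by
    rw [← hW, smul_smul, inv_mul_cancel, one_smul]
  have h2 : v.valuation ℚ S.Δ ≤ v.valuation ℚ W.Δ := by
    have h := valuation_Δ_smul_le_of_isMinimalAt v hminW C⁻¹ (by rw [hS']; exact hintS)
    rwa [hS'] at h
  have heq : v.valuation ℚ W.Δ = v.valuation ℚ S.Δ := le_antisymm h1 h2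
  -- translate into `ℓ`-adic valuations of integers
  have hΔW : W.Δ = (W.minimalDiscriminantInt : ℚ) := (cast_minimalDiscriminantInt W).symm
  have hneW : (W.minimalDiscriminantInt : ℚ) ≠ 0 := by exact_mod_cast minimalDiscriminantInt_ne_zero W
  rw [hΔW, hΔS, Rat.HeightOneSpectrum.valuation_eq_exp_neg_padicValRat v hneW,
    Rat.HeightOneSpectrum.valuation_eq_exp_neg_padicValRat v hneS, hv, WithZero.exp_inj, neg_inj,
    padicValRat.of_int, padicValRat.of_int, Nat.cast_inj] at heq
  exact heq

/-- **The auxiliary-prime clause of the door kernel, read off an integer model**: for a globally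
minimal `W = C • E_ℚ` and a prime `ℓ ≥ 5` with `ord_ℓ Δ(E) = 1`, `W` has multiplicative reduction
at `ℓ` and `ord_ℓ Δ_min(W) = 1` — so `p ∤ ord_ℓ Δ_min` for every prime `p`, the hypothesis `haux`
of `skinner_urban_main_conjecture` / `doorKernel_at_three` (at `ℓ = 5`, `p = 3`).
[cite: SilvermanAEC2009, VII.5 Prop. 5.1(b) and VII.1 Prop. 1.3(b)] -/
theorem haux_of_padicValInt_Δ_eq_one (E : WeierstrassCurve ℤ) (W : WeierstrassCurve ℚ)
    [W.IsElliptic] [W.IsGloballyMinimal] (C : VariableChange ℚ)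
    (hW : C • E.map (Int.castRingHom ℚ) = W) {ℓ : ℕ} [hℓ : Fact ℓ.Prime] (h5 : 5 ≤ ℓ)
    (h1 : padicValInt ℓ E.Δ = 1) (p : ℕ) (hp : p.Prime) (hℓp : ℓ ≠ p) :
    ∃ ℓ' : ℕ, ∃ _ : Fact ℓ'.Prime, ℓ' ≠ p ∧ W.HasMultiplicativeReductionAtPrime ℓ' ∧
      ¬ p ∣ padicValInt ℓ' W.minimalDiscriminantInt := by
  have hΔ0 : E.Δ ≠ 0 := by
    intro h0
    rw [h0, padicValInt.zero] at h1
    exact zero_ne_one h1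
  refine ⟨ℓ, hℓ, hℓp, ?_, ?_⟩
  · rw [← hW]; exact hasMultiplicativeReductionAtPrime_smul_map_of_padicValInt_Δ_eq_one E C h5 h1
  · rw [padicValInt_minimalDiscriminantInt_eq_of_smul_map_eq E W C hW hΔ0 (by omega), h1]
    exact hp.not_dvd_one

end Summit.BirchSwinnertonDyer.Rank2

end
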